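import Summits.Ventures.YMGap.Thresholds.OneLinkCasimirTwo
import Summits.Ventures.YMGap.Thresholds.OneLinkPoissonCovariance
import HarnessLib

/-!
# Venture YMGap — the one-link modulus beyond first order, part 3: the SECOND-ORDER covariance bound with symbolic
# `L²(ν_B)` norms (the Poisson solution `ψ₂` of `OneLinkCasimirTwo` fed into `cov_linear_le_of_poisson`)

HONEST FRAMING: venture file of the cell `pub-ymgap` (QuantumFields programme), strong-coupling LATTICE bookkeeping for `SU(N)`
lattice Yang–Mills; nothing about the continuum or the mass gap in the Clay sense.  No number of record moves here.

WHAT (`cov_linear_le_levelTwo`).  For `N ≥ 3`, `‖B‖_op < 1/2`, `ν_B(dg) ∝ exp(N Re tr(gB)) dg` on `SU(N)`, `u = Re tr(· Δ)` and every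
bounded measurable `L`-Lipschitz `φ`:
  `|Cov_ν(φ, N u)| ≤ (N²/(N²−1)) · L · [ √(∫ Γ(u+ψ₂, u+ψ₂) dν) + √(∫ Γ(c₃, c₃) dν) / (1/2 − ‖B‖_op) ]`,
`ψ₂ = −N²/(4(N²−4)) Re tr(QΔQB) + N/(2(N²−4)) Re(tr(QB)tr(QΔ)) − Re(tr(QB) conj tr(QΔ))/(4N)` the closed-form second-order Poisson
solution (`lap_psiTwo_add_gam`) and `c₃ = Γ(Re tr(· B), ψ₂)` its CUBIC remainder.  Compared with the first order
(`OneLinkEigenModulus.cov_linear_le`: `(N²/(N²−1))·L·‖Δ‖_F·(1/2 + 2‖B‖)/(1/2 − ‖B‖)`) the Bakry–Émery factor `1/(1/2 − ‖B‖_op)` now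
multiplies a cubic (`O(‖B‖²)`) quantity and every gradient enters through its `L²(ν_B)` norm.  Explicit majorants of the two norms
(cell note `HOME/p2/ONE-LINK-HIERARCHY.md` §4 (4.5)–(4.6): `≈ ‖Δ‖_F(0.89 + …)` and `≈ ‖Δ‖_F ‖B‖²(1.5 + …)` at large `N`) are the
next files; they give `K₂(∞, 0.19) ≈ 1.1` versus `K_ref ≈ 2.1` (paper, class A).

References: cell notes `HOME/p2/ONE-LINK-HIERARCHY.md` §3–§4; Shen–Zhu–Zhu, CMP 400 (2023) §4.1.
-/

noncomputable section

open scoped Matrix ComplexConjugate BigOperators ContDiff Matrix.Norms.Frobenius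
open Matrix Complex Finset MeasureTheory ProbabilityTheory
open Literature.MathematicalPhysics.QuantumFieldTheory
open Literature.MathematicalPhysics.QuantumFieldTheory.SUNBakryEmery

namespace Summit.Ventures.YMGap.OneLinkEigen

variable {N : ℕ}

/-- The second-order Poisson solution `ψ₂` is smooth. [folklore] -/
theorem contDiff_psiTwo (N : ℕ) (B Δ : Matrix (Fin N) (Fin N) ℂ) :
    ContDiff ℝ ∞ fun Q : Matrix (Fin N) (Fin N) ℂ =>
      -((N : ℝ) ^ 2 / (4 * ((N : ℝ) ^ 2 - 4))) * (Q * Δ * Q * B).trace.re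
        + ((N : ℝ) / (2 * ((N : ℝ) ^ 2 - 4))) * ((Q * B).trace * (Q * Δ).trace).re
        - (1 / (4 * (N : ℝ))) * ((Q * B).trace * (starRingEnd ℂ) (Q * Δ).trace).re :=
  ((contDiff_const.mul (contDiff_reTrQuad Δ B)).add (contDiff_const.mul (contDiff_reTrProd B Δ))).sub
    (contDiff_const.mul (contDiff_reTrProdConj B Δ))

/-- **THE SECOND-ORDER COVARIANCE BOUND (symbolic `L²(ν)` norms).**  `N ≥ 3`, `‖B‖_op < 1/2`, `φ` bounded measurable
`L`-Lipschitz (Frobenius) on `SU(N)`, `u = Re tr(· Δ)`, `ψ₂` the second-order Poisson solution, `c₃ = Γ(Re tr(· B), ψ₂)`: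
`|∫ φ · N Re tr(gΔ) dν − ∫ φ dν ∫ N Re tr(gΔ) dν| ≤ (N²/(N²−1)) · L · ( √(∫ Γ(u+ψ₂, u+ψ₂) dν) + √(∫ Γ(c₃,c₃) dν)/(1/2 − ‖B‖_op) )`.
[folklore] -/
theorem cov_linear_le_levelTwo (hN : 3 ≤ N) {B : Matrix (Fin N) (Fin N) ℂ} (hB : matrixOpNorm B < 1 / 2)
    (Δ : Matrix (Fin N) (Fin N) ℂ) (φ : SUN N → ℝ) {L : ℝ} (hφm : Measurable φ) (hφb : ∃ C, ∀ s, |φ s| ≤ C)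
    (hL : 0 ≤ L) (hφL : ∀ a b, |φ a - φ b| ≤ L * suFrobDist a b) :
    |∫ s, φ s * ((N : ℝ) * ((s : Matrix (Fin N) (Fin N) ℂ) * Δ).trace.re)
          ∂(haarProbability (SUN N)).tilted (fun g => (N : ℝ) * ((g : Matrix (Fin N) (Fin N) ℂ) * B).trace.re) -
        (∫ s, φ s ∂(haarProbability (SUN N)).tilted (fun g => (N : ℝ) * ((g : Matrix (Fin N) (Fin N) ℂ) * B).trace.re)) *
          ∫ s, (N : ℝ) * ((s : Matrix (Fin N) (Fin N) ℂ) * Δ).trace.re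
            ∂(haarProbability (SUN N)).tilted (fun g => (N : ℝ) * ((g : Matrix (Fin N) (Fin N) ℂ) * B).trace.re)| ≤
      (N : ℝ) ^ 2 / ((N : ℝ) ^ 2 - 1) * L *
        (Real.sqrt (∫ g, Gam (pot 1 Δ + fun Q : Matrix (Fin N) (Fin N) ℂ =>
              -((N : ℝ) ^ 2 / (4 * ((N : ℝ) ^ 2 - 4))) * (Q * Δ * Q * B).trace.re
                + ((N : ℝ) / (2 * ((N : ℝ) ^ 2 - 4))) * ((Q * B).trace * (Q * Δ).trace).re
                - (1 / (4 * (N : ℝ))) * ((Q * B).trace * (starRingEnd ℂ) (Q * Δ).trace).re)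
            (pot 1 Δ + fun Q : Matrix (Fin N) (Fin N) ℂ =>
              -((N : ℝ) ^ 2 / (4 * ((N : ℝ) ^ 2 - 4))) * (Q * Δ * Q * B).trace.re
                + ((N : ℝ) / (2 * ((N : ℝ) ^ 2 - 4))) * ((Q * B).trace * (Q * Δ).trace).re
                - (1 / (4 * (N : ℝ))) * ((Q * B).trace * (starRingEnd ℂ) (Q * Δ).trace).re) g
            ∂(haarProbability (SUN N)).tilted (fun g => (N : ℝ) * ((g : Matrix (Fin N) (Fin N) ℂ) * B).trace.re)) +
          Real.sqrt (∫ g, Gam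
              (Gam (pot 1 B) fun Q : Matrix (Fin N) (Fin N) ℂ =>
                -((N : ℝ) ^ 2 / (4 * ((N : ℝ) ^ 2 - 4))) * (Q * Δ * Q * B).trace.re
                  + ((N : ℝ) / (2 * ((N : ℝ) ^ 2 - 4))) * ((Q * B).trace * (Q * Δ).trace).re
                  - (1 / (4 * (N : ℝ))) * ((Q * B).trace * (starRingEnd ℂ) (Q * Δ).trace).re)
              (Gam (pot 1 B) fun Q : Matrix (Fin N) (Fin N) ℂ =>
                -((N : ℝ) ^ 2 / (4 * ((N : ℝ) ^ 2 - 4))) * (Q * Δ * Q * B).trace.re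
                  + ((N : ℝ) / (2 * ((N : ℝ) ^ 2 - 4))) * ((Q * B).trace * (Q * Δ).trace).re
                  - (1 / (4 * (N : ℝ))) * ((Q * B).trace * (starRingEnd ℂ) (Q * Δ).trace).re) g
            ∂(haarProbability (SUN N)).tilted (fun g => (N : ℝ) * ((g : Matrix (Fin N) (Fin N) ℂ) * B).trace.re)) /
            (1 / 2 - matrixOpNorm B)) :=
  cov_linear_le_of_poisson (by omega) hB Δ (contDiff_psiTwo N B Δ) (lap_psiTwo_add_gam hN B Δ) φ hφm hφb hL hφL

end Summit.Ventures.YMGap.OneLinkEigen
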